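import Summits.RiemannHypothesis.RiemannHypothesis.Theorems.SemilocalNegCertSeventyOneKinked2150
import HarnessLib

/-!
# Semi-local threshold of the `{∞,2,…,71}` form, negative side: `a*({2,…,71}) ≤ 1101 / 512 = 2.150390625` — the wall `q = 73` from a KINKED (piecewise-cubic) witness with slope breaks at the prime-atom images (part 23/30: the kernel facts piece 327 … piece 341 of 415 (imports part 1 only))

Cell `rh-explicit` (HOME `run/shared/lean/pub/rh-explicit/`), seat cc-s2-9 gen3 (HUMAN RULING D-0074 (D5) WEIL data engine; LADDER-RH column WEIL, rung DATA → W-P(P2);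
pipeline = cc-s2-4 gen8/gen11's piecewise-witness layer `SemilocalPiecewise{Witness,Increment,IncrementSum,Cert}.lean` + their float finder, every number
re-derived by an independent second engine E2 before filing; gen0/gen2 rows: `SemilocalNegCert{ThirteenKinked1423,…,FiftyThreeKinked2044}*`, capstone `SemilocalKinkedWallOffsets`).
HONEST FRAMING: RH-FREE theorems about the tree's `weilSemilocalThreshold S` of a TRUNCATED Weil form (finitely many places); nothing here bears on the
truth of RH; the lower clause `(log q)/2 ≤ a*(S_q)` at all primes IS RH and is untouched; the SIGN of `δ*(73)` is not claimed.

KINKED row for the wall `q = 73` (`S = {2,…,71}`): at `b = 1101 / 512 = 2.150390625 ≈ a*(S_73) + 0.0051` (DATA, two engines, cc-s2-6/cc-s2-3: `a*(S_73) = 2.1452531`)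
the polynomial × indicator class is far from negative (tree row `139/64`, `SemilocalNegCertUptoSeventyOne`, `δ*(73) ≤ 0.0266`), whereas an odd piecewise cubic with slope breaks at the images
`|b − log n|` (rounded to `/1024`) of the atoms `n ∈ {3,5,7,11,13,17,19,23,29,31,37,41,43,47,53,59,61,67,71}` (the odd-prime atoms; all atom images resp. all primes resp. primes + 4 + 9 scanned, kit j257393) is negative by `5.808e-03·‖G‖²`.
Instance: `S = {2, 3, 5, 7, 11, 13, 17, 19, 23, 29, 31, 37, 41, 43, 47, 53, 59, 61, 67, 71}`, `N = 77` (atom table `atomsUptoSeventyOne` / `atomsEnclose_UptoSeventyOne` of `SemilocalNegCertUptoSeventyOne.lean`), 20 pieces of degree ≤ 3, 415 `t`-pieces;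
TWO ENGINES on the witness before the kernel: cc-s2-4's float finder `λ_min = -5.8079e-03` and the seat's exact-in-`x` decimal engine E2 `R = -5.8116e-03` (no polar credit);
the exact kernel margin is the certificate's own rational arithmetic (farm report).  ⇒ **`a*({2,…,71}) ≤ 1101 / 512`, `δ*(73) < 0.005161`** (was `0.0266`).
No data is trusted: every bound is a `decide +kernel` fact.  Folklore throughout.
-/

set_option autoImplicit false
set_option linter.dupNamespace false  -- the mandated namespace repeats `RiemannHypothesis`
set_option Elab.async false  -- serialise the kernel facts: in parallel they exhaust the node's per-process heap (cc-s2-4 gen11, CC4-LEAN §16.10)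

noncomputable section

open Complex Filter Set MeasureTheory Topology
open scoped Real

namespace Summit.RiemannHypothesis.RiemannHypothesis.Theorems.SemilocalPolyWitness

open MeasureTheory Set Finset Real
open Literature.NumberTheory.LFunctions
open Summit.RiemannHypothesis.RiemannHypothesis.Theorems.MotivicDoor
open Summit.RiemannHypothesis.RiemannHypothesis.Theorems.MotivicDoor.SemilocalThreshold
open Summit.RiemannHypothesis.RiemannHypothesis.Theorems.MotivicDoor.SemilocalMarkov
open LQ

set_option maxHeartbeats 0 in
/-- kernel fact: piece `327` of `certSeventyOneKinked2150`. -/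
theorem check_SeventyOneKinked2150_piece327 : certSeventyOneKinked2150.checkPiecePW 327 = true := by
  decide +kernel

set_option maxHeartbeats 0 in
/-- kernel fact: piece `328` of `certSeventyOneKinked2150`. -/
theorem check_SeventyOneKinked2150_piece328 : certSeventyOneKinked2150.checkPiecePW 328 = true := by
  decide +kernel

set_option maxHeartbeats 0 in
/-- kernel fact: piece `329` of `certSeventyOneKinked2150`. -/
theorem check_SeventyOneKinked2150_piece329 : certSeventyOneKinked2150.checkPiecePW 329 = true := by
  decide +kernel

set_option maxHeartbeats 0 in
/-- kernel fact: piece `330` of `certSeventyOneKinked2150`. -/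
theorem check_SeventyOneKinked2150_piece330 : certSeventyOneKinked2150.checkPiecePW 330 = true := by
  decide +kernel

set_option maxHeartbeats 0 in
/-- kernel fact: piece `331` of `certSeventyOneKinked2150`. -/
theorem check_SeventyOneKinked2150_piece331 : certSeventyOneKinked2150.checkPiecePW 331 = true := by
  decide +kernel

set_option maxHeartbeats 0 in
/-- kernel fact: piece `332` of `certSeventyOneKinked2150`. -/
theorem check_SeventyOneKinked2150_piece332 : certSeventyOneKinked2150.checkPiecePW 332 = true := by
  decide +kernel

set_option maxHeartbeats 0 in
/-- kernel fact: piece `333` of `certSeventyOneKinked2150`. -/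
theorem check_SeventyOneKinked2150_piece333 : certSeventyOneKinked2150.checkPiecePW 333 = true := by
  decide +kernel

set_option maxHeartbeats 0 in
/-- kernel fact: piece `334` of `certSeventyOneKinked2150`. -/
theorem check_SeventyOneKinked2150_piece334 : certSeventyOneKinked2150.checkPiecePW 334 = true := by
  decide +kernel

set_option maxHeartbeats 0 in
/-- kernel fact: piece `335` of `certSeventyOneKinked2150`. -/
theorem check_SeventyOneKinked2150_piece335 : certSeventyOneKinked2150.checkPiecePW 335 = true := by
  decide +kernel

set_option maxHeartbeats 0 in
/-- kernel fact: piece `336` of `certSeventyOneKinked2150`. -/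
theorem check_SeventyOneKinked2150_piece336 : certSeventyOneKinked2150.checkPiecePW 336 = true := by
  decide +kernel

set_option maxHeartbeats 0 in
/-- kernel fact: piece `337` of `certSeventyOneKinked2150`. -/
theorem check_SeventyOneKinked2150_piece337 : certSeventyOneKinked2150.checkPiecePW 337 = true := by
  decide +kernel

set_option maxHeartbeats 0 in
/-- kernel fact: piece `338` of `certSeventyOneKinked2150`. -/
theorem check_SeventyOneKinked2150_piece338 : certSeventyOneKinked2150.checkPiecePW 338 = true := by
  decide +kernel

set_option maxHeartbeats 0 in
/-- kernel fact: piece `339` of `certSeventyOneKinked2150`. -/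
theorem check_SeventyOneKinked2150_piece339 : certSeventyOneKinked2150.checkPiecePW 339 = true := by
  decide +kernel

set_option maxHeartbeats 0 in
/-- kernel fact: piece `340` of `certSeventyOneKinked2150`. -/
theorem check_SeventyOneKinked2150_piece340 : certSeventyOneKinked2150.checkPiecePW 340 = true := by
  decide +kernel

set_option maxHeartbeats 0 in
/-- kernel fact: piece `341` of `certSeventyOneKinked2150`. -/
theorem check_SeventyOneKinked2150_piece341 : certSeventyOneKinked2150.checkPiecePW 341 = true := by
  decide +kernel

end Summit.RiemannHypothesis.RiemannHypothesis.Theorems.SemilocalPolyWitness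

end
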